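import Mathlib
import Literature.Computability.Complexity.Circuit

/-!
# Linear separation complexity and Boolean circuit size (Hrubeš 2020)

A NAMED FACT (unproved here): P. Hrubeš, *On ε-sensitive monotone computations*, Computational
Complexity 29 (2020), article 6 (= ECCC TR19-034), **Theorem 3**: for every Boolean function
`f : {0,1}^n → {0,1}`, `min_{ε>0} rk₊(M(f) - εJ) ≤ O(C(f) + n)`, where `M(f)` is the
`f⁻¹(0) × f⁻¹(1)` matrix of Hamming distances between rejecting and accepting inputs, `J` the
all-ones matrix, `rk₊` the non-negative rank and `C(f)` the Boolean circuit size of `f` (Theorem 3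
is Theorem 4 there — `sep(f) ≥ min_ε rk₊(M(f) - εJ) - 2n - 1` for the linear separation
complexity `sep` — combined with Valiant's / Yannakakis' `sep(f) ≤ O(C(f))`, Proposition 7(i)).
Consequence used in the tree: an `ε`-SENSITIVE lower bound on the non-negative rank of the explicit
matrix `M(f) - εJ` is a Boolean circuit lower bound for `f` (route PneNP/ConvexRankGates, crux
`ConvexGateBlind`, file `Summits/PneNP/PneNP/Theorems/ConvexRankGatesConvexGateBlindSparseBarrier`).

Design choices. Circuits are the tree's `Literature.Computability.Complexity.Circuit` over the full
binary basis `B2` (a constant factor away from the De Morgan circuits of the paper; the factor is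
absorbed in the constant `κ`, as is the additive `2n + 1`); "`rk₊ ≤ r`" is unfolded into an explicit
non-negative factorisation with `r` terms, indexed by `Fin r`; the `O(·)` is an existential
absolute constant `κ`. NOT here: the monotone version (`sep₊`, Theorem 20), strict rank, the
non-explicit `2^{Ω(n)}` lower bound of Theorem 3's second half.
-/

namespace Literature.Computability.Complexity

/-- **Hrubeš's separation bound** (Hrubeš 2020, Theorem 3): there is an absolute constant `κ`
such that for every finite input type `ι` (`n = #ι` variables), every Boolean function `f` on `ι`
and every circuit `C` over the full binary basis `B2` computing `f`, for some `ε > 0` the matrix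
`(Hamming(x, y) - ε)_{y ∈ f⁻¹(0), x ∈ f⁻¹(1)}` has a non-negative factorisation with at most
`κ · (size C + n + 1)` terms: `Hamming(x, y) - ε = ∑_{i<r} a_y(i) · b_x(i)` with `a, b ≥ 0` — i.e.
`min_{ε>0} rk₊(M(f) - εJ) ≤ O(C(f) + n)`.
-- TODO(general form): the paper states the bound for De Morgan circuit size `C(f)`; any complete
-- binary basis changes `C(f)` by a constant factor, absorbed in `κ`.
[cite: Hrubes2020, Thm. 3] -/
def hrubes_separation_rank_bound : Prop :=
  ∃ κ : ℕ, ∀ (ι : Type) [Fintype ι] [DecidableEq ι] (f : (ι → Bool) → Bool) (C : Circuit ι),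
    C.IsOver B2 → C.Computes f →
      ∃ ε : ℝ, 0 < ε ∧ ∃ r : ℕ, r ≤ κ * (C.size + Fintype.card ι + 1) ∧
        ∃ (a b : (ι → Bool) → Fin r → ℝ), (∀ y i, 0 ≤ a y i) ∧ (∀ x i, 0 ≤ b x i) ∧
          ∀ x y, f x = true → f y = false →
            (hammingDist x y : ℝ) - ε = ∑ i, a y i * b x i

end Literature.Computability.Complexity
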